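import Summits.Parity.GeneralizedHardyLittlewood.Theses.LeeYangFibres
import Summits.Parity.GeneralizedHardyLittlewood.Theorems.ModelHyperbolicity.Negative.ModelHyperbolicityUniformFalse

/-!
# Line `adjoint-saddle-locking` — checked skeleton for crux `ModelHyperbolicity` (stmt-Parity-14110)

Crux (route `LeeYangFibres`, rank 4; FIXED, concluded BY NAME by `ModelHyperbolicity_of`):
`∀ u ≥ 2, ∃ x₀, ∀ x ≥ x₀`, the rough-integer cell polynomial `P_{u,x}(z) = Σ_{j ≤ u} A_j(x) z^j`,
`A_j(x) = #{n ≤ x : x^{1/u} < P⁻(n), Ω(n) = j}`, has only real zeros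
(`= ∀ u ≥ 2, ∃ x₀, ∀ x ≥ x₀, RealRootedAt u x`, `Negative.crux_iff`, `Iff.rfl`).

## The line (idea `adjoint-saddle-locking`, ideator 1, round 1; triage r1: pass ×3)

Objects (this file): the Buchstab–Dickman CELL DENSITIES `I_j(u)` (`cellDensity j u`: `I_1 = 1` on `u > 1`,
`I_{j+2}(u) = ∫_{j+2}^{u} I_{j+1}(v−1) dv/(v−1)`, so `I_j(u) = 0` for `u ≤ j`, `I_2(u) = log (u−1)`), and the
LIMIT CELL POLYNOMIAL `G_u(X) = Σ_{i ≤ u−2} I_{i+1}(u) X^i ∈ ℝ[X]` (`limitPoly u`; `A_j(x)·log x/x → I_j(u)`).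
`G_u` is the value at `v = u − 1` of the solution of the delay equation `v ∂_v g = ζ g(v−1)`, `g ≡ 1` on
`(0,1]`, whose Laplace transform is `exp(ζ E₁(s))/s = e^{−γζ} s^{−ζ−1} e^{ζ Ein(s)}`.

Mechanism. For `ζ = −a < 0` deform the Laplace inversion contour to the pass `Re s = −σ₂(a/(u−1))`
(the larger real root of `σ e^{−σ} = a/(u−1)`, which exists iff `a/(u−1) ≤ 1/e`: the Lambert-W branch
point). The branch cut `[−σ₂, 0]` contributes the HANKEL LOOP
`(sin πa / π) · J(u,a)`, `J(u,a) = ∫_0^{σ₂} e^{−(u−1)σ + a·Ei(σ)} dσ/σ > 0` — a MANIFESTLY POSITIVE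
real integral (the truncated adjoint/Laplace integral of de Bruijn's method; `sin πa/π = ` the reflection
of `1/Γ(1−a)`, i.e. the `1/Γ` lattice seen in all numerics) — while the vertical line through the pass is
exponentially smaller, `≤ e^{−(u−1) h(a/(u−1))} · J` with `h > 0` on `[0, 1/e)`. Hence at half-integers
`a = k + ½` with `k ≤ (u−1)/3` the sign of `G_u(−k−½)` is `(−1)^k`: ONE SIMPLE ZERO LOCKED in each
`(−k−½, −k+½)`, `1 ≤ k ≤ K(u) := ⌊(u−1)/3⌋` (`stub_lockedSigns`). Beyond `−K−½` the zeros are counted by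
the two conjugate Lambert-W saddles (oscillatory bulk, `G_u ≈ 2 Re A e^{iθ}`: one simple zero per `π` of
phase), an Airy-type uniform form across `a/(u−1) ≈ 1/e`, and consecutive-monomial dominance in the
lacunary top (`z_{d} ≈ −I_{d}(u)/I_{d+1}(u)`): at least `u − 2 − K(u)` distinct zeros below `−K(u) − ½`
(`stub_bulkZeros`, the HARDEST stub). Locked + bulk `≥ u − 2 = deg G_u` distinct real zeros, so all zeros
of `G_u` are real and SIMPLE (`limitRealSimple_of_locked_bulk`, proved here). Alladi's cell asymptotics
(`stub_cellAsymptotics`) and the sign-alternation transfer at `u − 1` fixed test points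
(`stub_transfer`, the §F route of Disproof.lean) give the crux for every `u ≥ 2` with an `x₀(u)`
depending on `u`.

ACCESS NOTE (infrastructure): the idea-card text (`run/gate/evidence/…/adjoint-saddle-locking.md`) is
not mounted in this planner's jail and `ledger crux ideas` is empty (round-1 cards predate crux-write);
the three triagers could not read it either (TRIAGE-r1-1/2/3: "pass — UNREAD / abstain"). The line is
therefore reconstructed from the slug, the triagers' conditional readings, the twin card
`lambert-saddle-phase` (same Laplace symbol, verified by triager 2) and refuter-cdisprove-14108's
ANALYSIS.md §2 (edge Laplace + pass, `κ* ≈ 0.30`, Airy window at `κ = 1/e`, conjugate Lambert saddles,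
lacunary top). The stub statements are regime SIGN/ROOT-COUNT facts about `G_u` and do not depend on
which analytic tool (adjoint identities or contour deformation) proves them.

## Disproof.lean (gen-2, rc0, 0 sorries) honoured
* `modelHyperbolicity_false_without_two_le` — every stub carries `2 ≤ u`.
* `modelHyperbolicity_false_without_largeX` / `not_realRootedAt_eight` (`x = 8` fails for all `u ≥ 4`) and
  `not_monotone_in_x` — the line uses "large `x`" at `stub_transfer` only, which outputs `∃ x₀(u)`; no stub
  asserts `RealRootedAt u x` at any fixed `x`.
* `not_modelHyperbolicityUniform` / `not_realRootedAt_two_pow_pred` (`x₀(u) > 2^{u−1}`) — `x₀` is produced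
  per `u` (after `∀ u`); no stub is `u`-uniform in `x`.
* landed Negative lemmas (`Theorems/ModelHyperbolicity/Negative/*`, imported here): none refutes a stub —
  they concern fixed small `x` or uniform `x₀`, the stubs concern `G_u` and `x → ∞` at fixed `u`.

## Layout
namespace `…Cruxes.ModelHyperbolicity.AdjointSaddleLocking`; defs `cellDensity`, `limitPoly`,
`lockedCount`, `LimitRealSimple`, `CellAsymptotics`; four REGISTERED stubs `stub_cellAsymptotics`,
`stub_lockedSigns`, `stub_bulkZeros`, `stub_transfer` (sorry); sorry-free helpers
`card_roots_filter_of_alternating` (IVT count inside an interval), `limitRealSimple_of_locked_bulk`;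
`Registered.stub_…` = the stub statements under the stubs' own short names (skeleton audit: hypotheses
admissible iff registered stubs BY NAME); the composition `ModelHyperbolicity_of` (sorry-free, concludes the
route decl by name) and a wiring `example`.
-/

noncomputable section

namespace Summit.Parity.GeneralizedHardyLittlewood.Cruxes.ModelHyperbolicity.AdjointSaddleLocking

open Summit.Parity.GeneralizedHardyLittlewood.Theses.LeeYangFibres
open Summit.Parity.GeneralizedHardyLittlewood.Theorems.ModelHyperbolicity.Negative
open Polynomial Filter
open scoped Topology

/-! ## Objects -/

/-- Buchstab–Dickman cell densities `I_j(u)` (Alladi 1982; `A_j(x) ~ I_j(u)·x/log x` for `x^{1/u}`-rough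
`n ≤ x` with `Ω(n) = j`): `I_0 = 0`, `I_1(u) = [1 < u]`, and for `j ≥ 0`
`I_{j+2}(u) = ∫_{j+2}^{u} I_{j+1}(v−1) / (v−1) dv` (interval integral; for `u ≤ j+2` the integrand vanishes on
the interval, so `I_j(u) = 0` whenever `u ≤ j`).  `I_2(u) = log (u−1)` for `u ≥ 2`,
`I_3(u) = ∫_3^u log (v−2)/(v−1) dv`, `∂_u I_j(u) = I_{j−1}(u−1)/(u−1)`.  CHEAP CHECKS for provers (the
`ζ = ±1` specialisations of the delay equation): `Σ_j I_j(u) = u·ω(u)` (`Literature.NumberTheory.Sieve.buchstabOmega`,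
MV2007 (7.46)) and `Σ_j (−1)^{j−1} I_j(u) = ρ(u−1)` (Dickman; MV2007 Thm 7.10 is the Laplace symbol at `ζ = −1`). -/
def cellDensity : ℕ → ℝ → ℝ
  | 0, _ => 0
  | 1, u => if 1 < u then 1 else 0
  | (j + 2), u => ∫ v in ((j : ℝ) + 2)..u, cellDensity (j + 1) (v - 1) / (v - 1)

/-- The limit cell polynomial `G_u(X) = Σ_{i ≤ u−2} I_{i+1}(u) X^i ∈ ℝ[X]` (degree `u − 2`, leading
coefficient `I_{u−1}(u) > 0`, `G_u(0) = 1`): the coefficientwise limit of `(log x / x)·P_{u,x}(z)/z`. -/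
def limitPoly (u : ℕ) : ℝ[X] :=
  ∑ i ∈ Finset.range (u - 1), C (cellDensity (i + 1) (u : ℝ)) * X ^ i

/-- Number of LOCKED zeros claimed by the line: `K(u) = ⌊(u−1)/3⌋`, i.e. `a/(u−1) ≤ 1/3 < 1/e` up to
`O(1/u)` for the half-integer test points `a = k + ½`, `k ≤ K(u)`. -/
def lockedCount (u : ℕ) : ℕ := (u - 1) / 3

/-- "`G_u` has only real SIMPLE zeros": it has `u − 2` distinct real roots (and `deg G_u ≤ u − 2`). -/
def LimitRealSimple (u : ℕ) : Prop := u - 2 ≤ (limitPoly u).roots.toFinset.card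

/-- Alladi's cell asymptotics at roughness `u`: `A_j(x)·log x / x → I_j(u)` for `1 ≤ j < u`
(`cell u x j = A_j(x)` is the landed `Negative.cell`). -/
def CellAsymptotics (u : ℕ) : Prop :=
  ∀ j : ℕ, 1 ≤ j → j < u →
    Tendsto (fun x : ℕ => (cell u x j : ℝ) * Real.log (x : ℝ) / (x : ℝ)) atTop (𝓝 (cellDensity j (u : ℝ)))

/-! ## The four registered stubs -/

/-- **S1 · cell asymptotics (Alladi; provable now, size L).** For every `u ≥ 2` and `1 ≤ j < u`:
`A_j(x) log x / x → I_j(u)`.  Induction on `j` (condition on the least prime factor,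
`A_{j+1}(x; y) = Σ_{y < p} A_j(x/p; p)`-type Buchstab step + PNT + partial summation), exactly as the tree's
`Literature/NumberTheory/Sieve/RoughNumbersBuchstab*.lean` derives `Φ(x,y) ~ u ω(u) x/log x`; the top cell
`j = u − 1` included (`I_{u−1}(u) > 0`). Shared with every line of this crux and with `ModelCellFacts`.
[Alladi1982; Tenenbaum2015 III.6] -/
theorem stub_cellAsymptotics : ∀ u : ℕ, 2 ≤ u → CellAsymptotics u := by
  sorry

/-- **S2 · locked signs (the adjoint/Hankel-loop locking; size M–L).** For `u ≥ 2` and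
`0 ≤ k ≤ K(u) = ⌊(u−1)/3⌋`: `(−1)^k · G_u(−k−½) > 0`.  So `G_u` has a simple zero in each
`(−k−½, −k+½)`, `1 ≤ k ≤ K(u)` — the `1/Γ`-lattice.  Intended proof: `G_u(−a) = (sin πa/π)·J(u,a) + V(u,a)`
with `J = ∫_0^{σ₂} e^{−(u−1)σ + a Ei σ} dσ/σ > 0` (Hankel loop around the cut of `e^{−aE₁(s)}/s`) and
`|V| ≤ e^{−(u−1)h(a/(u−1)) + O(log u)} J`, `h > 0` on `[0,1/e)` (vertical line through the pass `−σ₂`);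
explicit remainders for `u ≥ U₀` (prover's dial), certified interval evaluation of `G_u(−k−½)` below `U₀`.
Numerics: locked zeros `−1, −2, −3.046 (u=10)`, `…, −33 to 1e−15, −40.0002 (u=120)`; deviation `< ½` up to
`a/(u−1) ≈ 1/e`. [HildebrandTenenbaum1993 (adjoint equation, special solutions `F`, `F_n`, scalar product);
arXiv:1212.1579 §2.7 (de Bruijn's contour `W` + adjoint steps 1–9); Tenenbaum2015 III.5–6; MontgomeryVaughan2007 Thm 7.10] -/
theorem stub_lockedSigns : ∀ u : ℕ, 2 ≤ u → ∀ k : ℕ, k ≤ lockedCount u →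
    0 < (-1 : ℝ) ^ k * (limitPoly u).eval (-(k : ℝ) - 1 / 2) := by
  sorry

/-- **S3 · bulk zeros beyond the locked range (HARDEST; size XL).** For `u ≥ 2`, `G_u` has at least
`u − 2 − K(u)` distinct real roots below `−K(u) − ½`.  Intended proof, three sub-regimes of `a = −ζ`:
(i) `K+½ < a < (1/e − δ)(u−1)`: the same Hankel-loop locking as S2; (ii) the window and the oscillatory
bulk `a ≳ (u−1)/e`: two conjugate saddles `s_± ` of `(u−1)s − a E₁(s) − log s` (Lambert-W branches),
`G_u(−a) = 2 Re[A(a) e^{iθ(a)}](1 + ε)`, sign changes at the points `θ ∈ πℤ`, with an Airy-uniform form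
where `s_+ → s_−`; (iii) lacunary top: for the last indices two consecutive monomials dominate and `G_u`
alternates at the geometric means of `I_i/I_{i+1}`.  The three counts add up to `u − 2 − K(u)` because the
phase is monotone and matches (i) and (iii) at the seams. Explicit remainders for `u ≥ U₀`, certified
evaluation below. [Tenenbaum2015 III.5; HildebrandTenenbaum1993 (oscillatory solutions `F_n`);
doi:10.1017/S0305004100032655 (Chester–Friedman–Ursell uniform two-saddle expansion); arXiv:1410.6601] -/
theorem stub_bulkZeros : ∀ u : ℕ, 2 ≤ u →
    u - 2 - lockedCount u ≤
      ((limitPoly u).roots.toFinset.filter (fun t => t < -(lockedCount u : ℝ) - 1 / 2)).card := by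
  sorry

/-- **S4 · transfer to finite `x` (size M).** If `G_u` has `u − 2` distinct real roots and the cells at
roughness `u` have Alladi asymptotics, then `P_{u,x}` is real-rooted for all large `x`: pick `u − 1` rational
points strictly separating the simple roots of `G_u` (strict sign alternation of `G_u` there), transport the
signs to `Q_{u,x} = Σ_{i<u} A_{i+1}(x) X^i` by `A_j log x/x → I_j(u)` (`A_u = 0`), and conclude with the §F
tools of Disproof.lean (`realRootedAt_of_alternating`: IVT count + `deg Q_{u,x} ≤ u − 2`; `u = 2`:
`Q = A_1(x) > 0`). Uses the load-bearing "large `x`" exactly here (`not_realRootedAt_eight`). [folklore] -/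
theorem stub_transfer : ∀ u : ℕ, 2 ≤ u → LimitRealSimple u → CellAsymptotics u →
    ∃ x₀ : ℕ, ∀ x : ℕ, x₀ ≤ x → RealRootedAt u x := by
  sorry

/-! ## Sorry-free glue: IVT root count inside an interval, and locked + bulk ⇒ real simple -/

/-- IVT COUNT inside an interval: strict sign alternation of `p` at `d + 1` increasing points
`t 0 < … < t d` gives `d` distinct roots in `(t 0, t d)`. -/
theorem card_roots_filter_of_alternating (p : ℝ[X]) {d : ℕ} (t : ℕ → ℝ)
    (ht : ∀ i < d, t i < t (i + 1)) (hsign : ∀ i < d, p.eval (t i) * p.eval (t (i + 1)) < 0) :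
    d ≤ (p.roots.toFinset.filter (fun r => t 0 < r ∧ r < t d)).card := by
  rcases Nat.eq_zero_or_pos d with rfl | hd
  · exact Nat.zero_le _
  have hp : p ≠ 0 := fun h => by
    have := hsign 0 hd
    simp [h] at this
  have hex : ∀ i < d, ∃ r, t i < r ∧ r < t (i + 1) ∧ p.IsRoot r := by
    intro i hi
    have hcont : ContinuousOn (fun s => p.eval s) (Set.Icc (t i) (t (i + 1))) :=
      p.continuous.continuousOn
    rcases mul_neg_iff.mp (hsign i hi) with ⟨ha, hb⟩ | ⟨ha, hb⟩
    · obtain ⟨r, hr, hr0⟩ := intermediate_value_Ioo' (ht i hi).le hcont ⟨hb, ha⟩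
      exact ⟨r, hr.1, hr.2, hr0⟩
    · obtain ⟨r, hr, hr0⟩ := intermediate_value_Ioo (ht i hi).le hcont ⟨ha, hb⟩
      exact ⟨r, hr.1, hr.2, hr0⟩
  choose! r hr using hex
  have htmono : ∀ n i, i + n ≤ d → t i ≤ t (i + n) := by
    intro n
    induction n with
    | zero => intro i _; simp
    | succ n ih =>
      intro i hi
      calc t i ≤ t (i + n) := ih i (by omega)
        _ ≤ t (i + n + 1) := (ht (i + n) (by omega)).le
  have hrmono : ∀ i j, i < j → j < d → r i < r j := by
    intro i j hij hjd
    calc r i < t (i + 1) := (hr i (by omega)).2.1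
      _ ≤ t (i + 1 + (j - (i + 1))) := htmono _ _ (by omega)
      _ = t j := by rw [show i + 1 + (j - (i + 1)) = j by omega]
      _ < r j := (hr j hjd).1
  have hinj : Set.InjOn r (Finset.range d : Set ℕ) := by
    intro i hi j hj hij
    simp only [Finset.coe_range, Set.mem_Iio] at hi hj
    by_contra hne
    rcases lt_or_gt_of_ne hne with h | h
    · exact absurd hij (hrmono i j h hj).ne
    · exact absurd hij.symm (hrmono j i h hi).ne
  calc d = ((Finset.range d).image r).card := by
        rw [Finset.card_image_of_injOn hinj, Finset.card_range]
    _ ≤ (p.roots.toFinset.filter (fun r => t 0 < r ∧ r < t d)).card := by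
        refine Finset.card_le_card fun s hs => ?_
        obtain ⟨i, hi, rfl⟩ := Finset.mem_image.mp hs
        rw [Finset.mem_range] at hi
        rw [Finset.mem_filter, Multiset.mem_toFinset, mem_roots hp]
        refine ⟨(hr i hi).2.2, ?_, ?_⟩
        · calc t 0 ≤ t (0 + i) := htmono i 0 (by omega)
            _ = t i := by rw [zero_add]
            _ < r i := (hr i hi).1
        · calc r i < t (i + 1) := (hr i hi).2.1
            _ ≤ t (i + 1 + (d - (i + 1))) := htmono _ _ (by omega)
            _ = t d := by rw [show i + 1 + (d - (i + 1)) = d by omega]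

/-- **Locked + bulk ⇒ real simple.** The `K(u) + 1` alternating signs at `−K−½ < … < −½` give `K(u)`
distinct roots in `(−K−½, −½)`, disjoint from the `u − 2 − K(u)` roots below `−K−½`; together
`≥ u − 2 ≥ deg G_u` distinct real roots. -/
theorem limitRealSimple_of_locked_bulk {u : ℕ}
    (hlock : ∀ k : ℕ, k ≤ lockedCount u → 0 < (-1 : ℝ) ^ k * (limitPoly u).eval (-(k : ℝ) - 1 / 2))
    (hbulk : u - 2 - lockedCount u ≤
      ((limitPoly u).roots.toFinset.filter (fun t => t < -(lockedCount u : ℝ) - 1 / 2)).card) :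
    LimitRealSimple u := by
  set K := lockedCount u with hK
  set p := limitPoly u with hp
  -- increasing test points `t i = −K − ½ + i`, `i = 0, …, K`
  set t : ℕ → ℝ := fun i => -(K : ℝ) - 1 / 2 + i with ht_def
  have ht : ∀ i < K, t i < t (i + 1) := fun i _ => by
    simp only [ht_def]; push_cast; linarith
  have hsign : ∀ i < K, p.eval (t i) * p.eval (t (i + 1)) < 0 := by
    intro i hi
    have h1 := hlock (K - i) (Nat.sub_le _ _)
    have h2 := hlock (K - (i + 1)) (Nat.sub_le _ _)
    have e1 : t i = -((K - i : ℕ) : ℝ) - 1 / 2 := by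
      simp only [ht_def]; rw [Nat.cast_sub (by omega : i ≤ K)]; ring
    have e2 : t (i + 1) = -((K - (i + 1) : ℕ) : ℝ) - 1 / 2 := by
      simp only [ht_def]; rw [Nat.cast_sub (by omega : i + 1 ≤ K)]; push_cast; ring
    rw [e1, e2]
    have hpow : (-1 : ℝ) ^ (K - i) = -(-1 : ℝ) ^ (K - (i + 1)) := by
      rw [show K - i = (K - (i + 1)) + 1 by omega, pow_succ]; ring
    rw [hpow] at h1
    rcases neg_one_pow_eq_or ℝ (K - (i + 1)) with h | h
    · rw [h] at h1 h2
      exact mul_neg_of_neg_of_pos (by linarith) (by linarith)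
    · rw [h] at h1 h2
      exact mul_neg_of_pos_of_neg (by linarith) (by linarith)
  have hlocked : K ≤ (p.roots.toFinset.filter (fun r => t 0 < r ∧ r < t K)).card :=
    card_roots_filter_of_alternating p t ht hsign
  have ht0 : t 0 = -(K : ℝ) - 1 / 2 := by simp [ht_def]
  have hdisj : Disjoint (p.roots.toFinset.filter (fun r => r < -(K : ℝ) - 1 / 2))
      (p.roots.toFinset.filter (fun r => t 0 < r ∧ r < t K)) := by
    rw [Finset.disjoint_filter]
    intro r _ hrA hrB
    rw [ht0] at hrB
    linarith [hrB.1]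
  have hsub : p.roots.toFinset.filter (fun r => r < -(K : ℝ) - 1 / 2) ∪
      p.roots.toFinset.filter (fun r => t 0 < r ∧ r < t K) ⊆ p.roots.toFinset :=
    Finset.union_subset (Finset.filter_subset _ _) (Finset.filter_subset _ _)
  show u - 2 ≤ p.roots.toFinset.card
  calc u - 2 ≤ (u - 2 - K) + K := le_tsub_add
    _ ≤ (p.roots.toFinset.filter (fun r => r < -(K : ℝ) - 1 / 2)).card +
          (p.roots.toFinset.filter (fun r => t 0 < r ∧ r < t K)).card := add_le_add hbulk hlocked
    _ = (p.roots.toFinset.filter (fun r => r < -(K : ℝ) - 1 / 2) ∪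
          p.roots.toFinset.filter (fun r => t 0 < r ∧ r < t K)).card :=
        (Finset.card_union_of_disjoint hdisj).symm
    _ ≤ p.roots.toFinset.card := Finset.card_le_card hsub

/-! ## Registered statements, keyed by the stubs' own names -/

/-! `Registered.stub_X` IS the statement of the registered stub `stub_X` (via `type_of%`, no retyping),
under the stub's short name, so that the skeleton audit (`#h21_check_skeleton`: hypotheses admissible iff
route items or registered stubs BY NAME) reads the hypotheses of `ModelHyperbolicity_of` as the four stubs. -/
namespace Registered

/-- Statement of `stub_cellAsymptotics`. -/
abbrev stub_cellAsymptotics : Prop :=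
  type_of% _root_.Summit.Parity.GeneralizedHardyLittlewood.Cruxes.ModelHyperbolicity.AdjointSaddleLocking.stub_cellAsymptotics
/-- Statement of `stub_lockedSigns`. -/
abbrev stub_lockedSigns : Prop :=
  type_of% _root_.Summit.Parity.GeneralizedHardyLittlewood.Cruxes.ModelHyperbolicity.AdjointSaddleLocking.stub_lockedSigns
/-- Statement of `stub_bulkZeros`. -/
abbrev stub_bulkZeros : Prop :=
  type_of% _root_.Summit.Parity.GeneralizedHardyLittlewood.Cruxes.ModelHyperbolicity.AdjointSaddleLocking.stub_bulkZeros
/-- Statement of `stub_transfer`. -/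
abbrev stub_transfer : Prop :=
  type_of% _root_.Summit.Parity.GeneralizedHardyLittlewood.Cruxes.ModelHyperbolicity.AdjointSaddleLocking.stub_transfer

end Registered

/-- Consistency check: the registered stubs prove their name-keyed statements. -/
example : Registered.stub_cellAsymptotics ∧ Registered.stub_lockedSigns ∧ Registered.stub_bulkZeros ∧
    Registered.stub_transfer :=
  ⟨stub_cellAsymptotics, stub_lockedSigns, stub_bulkZeros, stub_transfer⟩

/-! ## The composition (kernel-checked, no sorry of its own) -/

/-- **Skeleton theorem.** `S1 → S2 → S3 → S4 → ModelHyperbolicity` BY NAME: for `u ≥ 2`, locked signs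
(S2) and bulk zeros (S3) make `G_u` real simple (`limitRealSimple_of_locked_bulk`); the transfer (S4) fed
with the cell asymptotics (S1) gives `∃ x₀ ∀ x ≥ x₀, RealRootedAt u x`, i.e. the crux (`crux_iff`). -/
theorem ModelHyperbolicity_of (h₁ : Registered.stub_cellAsymptotics) (h₂ : Registered.stub_lockedSigns)
    (h₃ : Registered.stub_bulkZeros) (h₄ : Registered.stub_transfer) :
    Summit.Parity.GeneralizedHardyLittlewood.Theses.LeeYangFibres.ModelHyperbolicity := by
  rw [crux_iff]
  intro u hu
  exact h₄ u hu (limitRealSimple_of_locked_bulk (h₂ u hu) (h₃ u hu)) (h₁ u hu)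

/-- Wiring check: the registered stubs feed `ModelHyperbolicity_of` as stated (an `example`, so that
`ModelHyperbolicity_of` stays the unique theorem of this file concluding the crux by name). -/
example : Summit.Parity.GeneralizedHardyLittlewood.Theses.LeeYangFibres.ModelHyperbolicity :=
  ModelHyperbolicity_of stub_cellAsymptotics stub_lockedSigns stub_bulkZeros stub_transfer

end Summit.Parity.GeneralizedHardyLittlewood.Cruxes.ModelHyperbolicity.AdjointSaddleLocking

end
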